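import Summits.ABC.ABC.Theses.PadicPrimesKummerThird
import Summits.ABC.StewartYu.PadicPrimesKummerThirdRung
import HarnessLib

/-!
# The crux texts `Y07Odd` / `Y07Two` of route `PadicPrimesKummerThird` from the PRIMES-ONLY
# `log B` form of Yu 2007 (cell `abc-stewartyu`; cross-ladder literature-typing seat `lit-abc-yu2007`)

Sequel to `Y07OfYu2007.lean` (lit g5: the cruxes from the δ-form fact of record
`Literature.Barriers.ABC.yu2007_padicLogForm_rat` through Pasten's clause). Here the input is the
cleaner **primes-only `log B` text** of Yu 2007 ("consequence of the Main Theorem on p. 190",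
case `K = ℚ`, `αᵢ` = distinct rational primes):

  for every prime `p`, every set `S` of `#S ≥ 2` primes, `|e_q| ≤ B` (`B ≥ 3`), `∏ q^{e_q} ≠ 1`:
  `ord_p(∏_{q∈S} q^{e_q} − 1) < (16e)^{2(#S+1)} (#S)^{5/2} log(2#S) log 2 · p/(log p)² · log B · ∏_{q∈S} log q`,

which is the conclusion VERBATIM of
`Literature.NumberTheory.DiophantineGeometry.Dioph.yu2007_padicLogForm_logB_primes` (proposal
p455041, `Literature/NumberTheory/DiophantineGeometry/Yu2007PadicLogFormsConsequences.lean`,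
proved there from the typed fact `Dioph.yu2007_padicLogForm_logB_rat`). Taken here as a
HYPOTHESIS `hL` (so this file does not wait for that module), it gives the two crux statements BY
NAME with `c₆ = 16·(16e)⁴`: multiply by `log p`, bound `log B ≤ log p + log B + log log A`, and
`(16e)^{2(n+1)} n^{5/2} log(2n) log 2 ≤ (16(16e)⁴)ⁿ`; the one-prime case `#S = 1` (outside Yu's
`n ≥ 2`) is p2's elementary rung `Summit.ABC.StewartYu.y07_card_one` (`4^{#S}`).
Once p455041 lands: `y07Odd_of_yu2007_logB h := y07Odd_of_logBPrimes (yu2007_padicLogForm_logB_primes h)`.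

WHAT THIS IS NOT: nothing is closed — the `log B` fact is an unproved named fact (Yu 2007 is
cite-only, `acq-02484`); the route's content is proving `Y07Odd`/`Y07Two` WITHOUT it. This file only
certifies, in the kernel, that the typed primes-only statement has the shape the cruxes consume
(T1 dossier: crux ⇐ typed literature, second line of descent). [folklore]
-/

namespace Summit.ABC.StewartYu

namespace Y07LogB

open Finset Real
open Summit.ABC.ABC.Theses.PadicPrimesKummerThird
open Summit.ABC.ABC.Theorems.PadicPrimesYuNinetyRung (loglog_max_four_ge)

/-- The constant of the primes-only `log B` text is at most `(16(16e)⁴)ⁿ` (`n ≥ 1`). [folklore] -/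
private theorem const_le_pow {n : ℕ} (hn : 1 ≤ n) :
    (16 * Real.exp 1) ^ (2 * (n + 1)) * (n : ℝ) ^ (5 / 2 : ℝ) * Real.log (2 * n) * Real.log 2 ≤
      ((16 * Real.exp 1) ^ 4 * 16) ^ n := by
  have he1 : (1 : ℝ) ≤ Real.exp 1 := Real.one_le_exp (by norm_num)
  have hc1 : (1 : ℝ) ≤ 16 * Real.exp 1 := by nlinarith
  have hnR : (1 : ℝ) ≤ n := by exact_mod_cast hn
  have hn2 : (n : ℝ) ≤ (2 : ℝ) ^ n := by exact_mod_cast (Nat.lt_two_pow_self).le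
  -- `c^{2(n+1)} ≤ c^{4n}`
  have h1 : (16 * Real.exp 1) ^ (2 * (n + 1)) ≤ (16 * Real.exp 1) ^ (4 * n) :=
    pow_le_pow_right₀ hc1 (by omega)
  -- `n^{5/2} ≤ n³ ≤ (2ⁿ)³ = 8ⁿ`
  have h2 : (n : ℝ) ^ (5 / 2 : ℝ) ≤ (8 : ℝ) ^ n := by
    have h21 : (n : ℝ) ^ (5 / 2 : ℝ) ≤ (n : ℝ) ^ (3 : ℝ) :=
      Real.rpow_le_rpow_of_exponent_le hnR (by norm_num)
    have h22 : (n : ℝ) ^ (3 : ℝ) = (n : ℝ) ^ (3 : ℕ) := by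
      rw [show (3 : ℝ) = ((3 : ℕ) : ℝ) by norm_num, Real.rpow_natCast]
    have h23 : (n : ℝ) ^ (3 : ℕ) ≤ ((2 : ℝ) ^ n) ^ (3 : ℕ) :=
      pow_le_pow_left₀ (by linarith) hn2 3
    have h24 : ((2 : ℝ) ^ n) ^ (3 : ℕ) = (8 : ℝ) ^ n := by
      rw [← pow_mul, mul_comm, pow_mul]; norm_num
    calc (n : ℝ) ^ (5 / 2 : ℝ) ≤ (n : ℝ) ^ (3 : ℝ) := h21
      _ = (n : ℝ) ^ (3 : ℕ) := h22
      _ ≤ ((2 : ℝ) ^ n) ^ (3 : ℕ) := h23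
      _ = (8 : ℝ) ^ n := h24
  -- `log(2n) ≤ 2ⁿ`
  have h3 : Real.log (2 * n) ≤ (2 : ℝ) ^ n := by
    have hlog2 : Real.log 2 ≤ 1 := by
      have := Real.log_two_lt_d9; linarith
    have hlogn : Real.log n ≤ (n : ℝ) - 1 := Real.log_le_sub_one_of_pos (by linarith)
    rw [Real.log_mul (by norm_num) (by linarith)]
    linarith
  have h4 : Real.log 2 ≤ 1 := by have := Real.log_two_lt_d9; linarith
  -- assemble
  have hC : 0 ≤ Real.log (2 * n) := Real.log_nonneg (by linarith)
  have hD : 0 ≤ Real.log 2 := Real.log_nonneg (by norm_num)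
  have e1 : (16 * Real.exp 1) ^ (4 * n) = ((16 * Real.exp 1) ^ 4) ^ n := pow_mul _ 4 n
  have e2 : (8 : ℝ) ^ n * 2 ^ n = 16 ^ n := by rw [← mul_pow]; norm_num
  have e3 : ((16 * Real.exp 1) ^ 4) ^ n * (16 : ℝ) ^ n = ((16 * Real.exp 1) ^ 4 * 16) ^ n :=
    (mul_pow _ _ n).symm
  calc (16 * Real.exp 1) ^ (2 * (n + 1)) * (n : ℝ) ^ (5 / 2 : ℝ) * Real.log (2 * n) * Real.log 2
      ≤ (16 * Real.exp 1) ^ (4 * n) * (8 : ℝ) ^ n * (2 : ℝ) ^ n * 1 := by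
        gcongr
    _ = ((16 * Real.exp 1) ^ 4) ^ n * ((8 : ℝ) ^ n * 2 ^ n) := by rw [e1]; ring
    _ = ((16 * Real.exp 1) ^ 4) ^ n * (16 : ℝ) ^ n := by rw [e2]
    _ = ((16 * Real.exp 1) ^ 4 * 16) ^ n := e3

/-- **Master lemma.** The primes-only `log B` text of Yu 2007 (hypothesis `hL`, `#S ≥ 2`) together
with the elementary one-prime rung give, at EVERY prime `p ∉ S` and every nonempty `S`:
`ord_p(∏ q^{e_q} − 1) · log p < (16(16e)⁴)^{#S} · (p/log p) · (log p + log B + log log A) · ∏ log q`.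
[folklore] -/
theorem y07_of_logBPrimes
    (hL : ∀ (p : ℕ), p.Prime → ∀ (S : Finset ℕ), (∀ q ∈ S, q.Prime) → 2 ≤ S.card →
      ∀ (e : ℕ → ℤ) (B : ℝ), 3 ≤ B → (∀ q ∈ S, (|e q| : ℝ) ≤ B) →
      ∏ q ∈ S, (q : ℚ) ^ e q ≠ 1 →
      (padicValRat p (∏ q ∈ S, (q : ℚ) ^ e q - 1) : ℝ) <
        (16 * Real.exp 1) ^ (2 * (S.card + 1)) * (S.card : ℝ) ^ (5 / 2 : ℝ) *
            Real.log (2 * S.card) * Real.log 2 *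
          ((p : ℝ) / Real.log p ^ 2) * Real.log B * ∏ q ∈ S, Real.log (q : ℝ)) :
    ∀ (p : ℕ), p.Prime → ∀ (S : Finset ℕ), (∀ q ∈ S, q.Prime) → p ∉ S → S.Nonempty →
    ∀ (e : ℕ → ℤ) (B : ℝ), 3 ≤ B → (∀ q ∈ S, (|e q| : ℝ) ≤ B) →
    ∏ q ∈ S, (q : ℚ) ^ e q ≠ 1 →
    (padicValRat p (∏ q ∈ S, (q : ℚ) ^ e q - 1) : ℝ) * Real.log p <
      ((16 * Real.exp 1) ^ 4 * 16) ^ S.card * ((p : ℝ) / Real.log p) *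
        (Real.log p + Real.log B + Real.log (Real.log ((max 4 (S.sup id) : ℕ) : ℝ))) *
        ∏ q ∈ S, Real.log (q : ℝ) := by
  intro p hp S hS hpS hne e B hB heB hne1
  set c : ℝ := (16 * Real.exp 1) ^ 4 * 16 with hc
  set n : ℕ := S.card with hn
  have hn1 : 1 ≤ n := hne.card_pos
  -- positivity bookkeeping
  have hp2 : (2 : ℝ) ≤ p := by exact_mod_cast hp.two_le
  have hlogp : 0 < Real.log p := Real.log_pos (by linarith)
  have hlogB : 1 ≤ Real.log B := by
    rw [← Real.log_exp 1]
    exact Real.log_le_log (Real.exp_pos 1) (by have := Real.exp_one_lt_d9; linarith)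
  have hll : 0 < Real.log (Real.log ((max 4 (S.sup id) : ℕ) : ℝ)) := by
    have := loglog_max_four_ge (S.sup id); linarith
  set L : ℝ := Real.log p + Real.log B + Real.log (Real.log ((max 4 (S.sup id) : ℕ) : ℝ)) with hLdef
  have hBL : Real.log B ≤ L := by rw [hLdef]; linarith
  have hL0 : 0 < L := by linarith
  have hq2 : ∀ q ∈ S, (2 : ℝ) ≤ q := fun q hq => by exact_mod_cast (hS q hq).two_le
  have hP : 0 < ∏ q ∈ S, Real.log (q : ℝ) :=
    Finset.prod_pos fun q hq => Real.log_pos (by linarith [hq2 q hq])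
  have hpl : 0 < (p : ℝ) / Real.log p := div_pos (by linarith) hlogp
  have he1 : (1 : ℝ) ≤ Real.exp 1 := Real.one_le_exp (by norm_num)
  have hc4 : (4 : ℝ) ≤ c := by
    rw [hc]
    have h16e : (1 : ℝ) ≤ 16 * Real.exp 1 := by nlinarith
    have h16 : (1 : ℝ) ≤ (16 * Real.exp 1) ^ 4 := one_le_pow₀ h16e
    nlinarith
  rcases Nat.lt_or_ge n 2 with hlt | hge
  · -- one prime: p2's elementary rung, `4^{#S} ≤ c^{#S}`
    have hcard : S.card ≤ 1 := by omega
    have h := y07_card_one p hp S hS hpS hne hcard e B hB heB hne1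
    have hmono : (4 : ℝ) ^ S.card ≤ c ^ S.card := pow_le_pow_left₀ (by norm_num) hc4 _
    have hrest : 0 ≤ ((p : ℝ) / Real.log p) * L * ∏ q ∈ S, Real.log (q : ℝ) := by positivity
    calc (padicValRat p (∏ q ∈ S, (q : ℚ) ^ e q - 1) : ℝ) * Real.log p
        < (4 : ℝ) ^ S.card * ((p : ℝ) / Real.log p) * L * ∏ q ∈ S, Real.log (q : ℝ) := h
      _ = (4 : ℝ) ^ S.card * (((p : ℝ) / Real.log p) * L * ∏ q ∈ S, Real.log (q : ℝ)) := by ring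
      _ ≤ c ^ S.card * (((p : ℝ) / Real.log p) * L * ∏ q ∈ S, Real.log (q : ℝ)) :=
          mul_le_mul_of_nonneg_right hmono hrest
      _ = c ^ S.card * ((p : ℝ) / Real.log p) * L * ∏ q ∈ S, Real.log (q : ℝ) := by ring
  · -- at least two primes: the `log B` text
    have h := hL p hp S hS hge e B hB heB hne1
    set C : ℝ := (16 * Real.exp 1) ^ (2 * (S.card + 1)) * (S.card : ℝ) ^ (5 / 2 : ℝ) *
        Real.log (2 * S.card) * Real.log 2 with hCdef
    have hC : C ≤ c ^ S.card := const_le_pow hn1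
    -- multiply by `log p`: `(p/(log p)²)·log p = p/log p`
    have hid0 : ((p : ℝ) / Real.log p ^ 2) * Real.log p = (p : ℝ) / Real.log p := by
      rw [div_mul_eq_mul_div, sq, mul_div_mul_right _ _ hlogp.ne']
    have h1 : (padicValRat p (∏ q ∈ S, (q : ℚ) ^ e q - 1) : ℝ) * Real.log p <
        C * ((p : ℝ) / Real.log p) * Real.log B * ∏ q ∈ S, Real.log (q : ℝ) := by
      have h' := mul_lt_mul_of_pos_right h hlogp
      calc (padicValRat p (∏ q ∈ S, (q : ℚ) ^ e q - 1) : ℝ) * Real.log p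
          < C * ((p : ℝ) / Real.log p ^ 2) * Real.log B * (∏ q ∈ S, Real.log (q : ℝ)) *
              Real.log p := h'
        _ = C * (((p : ℝ) / Real.log p ^ 2) * Real.log p) * Real.log B *
              ∏ q ∈ S, Real.log (q : ℝ) := by ring
        _ = C * ((p : ℝ) / Real.log p) * Real.log B * ∏ q ∈ S, Real.log (q : ℝ) := by rw [hid0]
    have h2 : C * ((p : ℝ) / Real.log p) * Real.log B * ∏ q ∈ S, Real.log (q : ℝ) ≤
        c ^ S.card * ((p : ℝ) / Real.log p) * L * ∏ q ∈ S, Real.log (q : ℝ) := by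
      have hC0 : 0 ≤ C := by
        rw [hCdef]
        have : 0 ≤ Real.log (2 * (S.card : ℝ)) := Real.log_nonneg (by
          have : (1 : ℝ) ≤ S.card := by exact_mod_cast hn1
          linarith)
        have : 0 ≤ Real.log (2 : ℝ) := Real.log_nonneg (by norm_num)
        positivity
      have hB0 : 0 ≤ Real.log B := by linarith
      gcongr
    exact lt_of_lt_of_le h1 h2

/-- **`Y07Odd` (item stmt-ABC-19658) from the primes-only `log B` text of Yu 2007** (hypothesis
`hL` = conclusion of `Dioph.yu2007_padicLogForm_logB_primes`), by name; `c₆ = 16(16e)⁴`.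
CONDITIONAL — nothing is closed. [folklore] -/
theorem y07Odd_of_logBPrimes
    (hL : ∀ (p : ℕ), p.Prime → ∀ (S : Finset ℕ), (∀ q ∈ S, q.Prime) → 2 ≤ S.card →
      ∀ (e : ℕ → ℤ) (B : ℝ), 3 ≤ B → (∀ q ∈ S, (|e q| : ℝ) ≤ B) →
      ∏ q ∈ S, (q : ℚ) ^ e q ≠ 1 →
      (padicValRat p (∏ q ∈ S, (q : ℚ) ^ e q - 1) : ℝ) <
        (16 * Real.exp 1) ^ (2 * (S.card + 1)) * (S.card : ℝ) ^ (5 / 2 : ℝ) *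
            Real.log (2 * S.card) * Real.log 2 *
          ((p : ℝ) / Real.log p ^ 2) * Real.log B * ∏ q ∈ S, Real.log (q : ℝ)) :
    Y07Odd :=
  ⟨(16 * Real.exp 1) ^ 4 * 16, fun p hp _ S hS hpS hne e B hB heB hne1 =>
    y07_of_logBPrimes hL p hp S hS hpS hne e B hB heB hne1⟩

/-- **`Y07Two` (item stmt-ABC-19659) from the primes-only `log B` text of Yu 2007** (hypothesis
`hL`), by name; `c₆ = 16(16e)⁴`. CONDITIONAL — nothing is closed. [folklore] -/
theorem y07Two_of_logBPrimes
    (hL : ∀ (p : ℕ), p.Prime → ∀ (S : Finset ℕ), (∀ q ∈ S, q.Prime) → 2 ≤ S.card →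
      ∀ (e : ℕ → ℤ) (B : ℝ), 3 ≤ B → (∀ q ∈ S, (|e q| : ℝ) ≤ B) →
      ∏ q ∈ S, (q : ℚ) ^ e q ≠ 1 →
      (padicValRat p (∏ q ∈ S, (q : ℚ) ^ e q - 1) : ℝ) <
        (16 * Real.exp 1) ^ (2 * (S.card + 1)) * (S.card : ℝ) ^ (5 / 2 : ℝ) *
            Real.log (2 * S.card) * Real.log 2 *
          ((p : ℝ) / Real.log p ^ 2) * Real.log B * ∏ q ∈ S, Real.log (q : ℝ)) :
    Y07Two :=
  ⟨(16 * Real.exp 1) ^ 4 * 16, fun S hS h2S hne e B hB heB hne1 => by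
    have h := y07_of_logBPrimes hL 2 Nat.prime_two S hS h2S hne e B hB heB hne1
    simpa only [Nat.cast_ofNat] using h⟩

end Y07LogB

end Summit.ABC.StewartYu
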